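import Literature.NumberTheory.PAdicHodge.HodgeTateUnramified
import Literature.NumberTheory.GaloisRepresentations.LabelledHodgeTateWeights
import Mathlib.LinearAlgebra.TensorProduct.Basis
import HarnessLib

/-!
# Unramified representations have Hodge–Tate weight `0`

Continuation of `HodgeTateUnramified` (unramified ⇒ `B_HT`-admissible). We compute the Hodge–Tate
weights: for a continuous finite-dimensional `ℚ_p`-linear representation `ρ` of `Γ_F` with trivial
inertia action,

  `(hodgeTatePeriodRingData hp).hodgeTateWeights ρ = {0, …, 0}` (`dim ρ` times)

(`hodgeTateWeights_of_unramified`) — the `B_HT` form of clause (F3) `UnramifiedWeightsZero` of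
`IsFontaineDatum` (Fontaine 1994, Exp. III §5: unramified representations are crystalline with
`Fil⁰ D = D`, `Fil¹ D = 0`; Sen: `ℂ`-admissible representations are Hodge–Tate of weight `0`).

Proof. Re-running the first half of the tree's `PeriodRingData.isAdmissible_of_unramified` (integral
frame `b, r`, period matrix `X ∈ GL_N(𝒪̂_{F_nr})`, `UnramifiedPeriodMatrix`), the invariant vectors
`w_j = Σ_i ι(X_{ij}) ⊗ b_i` form an `F`-basis of `D = (B_HT ⊗ ρ)^{Γ_F}` (they are independent and
`dim D = N` by `isAdmissible_hodgeTate_of_unramified`), with all coefficients `ι(X_{ij}) ∈ ℂ_F = `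
degree `0` of `B_HT`. Hence `D ⊆ Fil^i B_HT ⊗ V` for `i ≤ 0`, while an element of `D` lying in
`Fil¹ B_HT ⊗ V` has degree-`0` coordinates in `Fil¹`, i.e. `0`, and `X` is invertible: `Fil^i D = D`
for `i ≤ 0` and `0` for `i ≥ 1` (`finrank_filD_of_unramified`). The coordinate bookkeeping in
`B ⊗_{ℚ_p} V` along a basis of `V` is the generic `PeriodRingData.mem_fil_of_sum_tmul_mem_filTensor`
(Mathlib `TensorProduct.equivFinsuppOfBasisRight`).

## References

* J.-M. Fontaine, *Représentations p-adiques semi-stables*, Astérisque 223 (1994), Exp. III §5. [FontaineAsterisque223III]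
* J.-M. Fontaine, Y. Ouyang, *Theory of p-adic Galois representations*, Prop. 2.14, §5.1. [FontaineOuyang2022]
-/

noncomputable section

open ValuativeRel Field UniformSpace IsLocalRing Matrix TensorProduct
open scoped MatrixGroups TensorProduct

namespace Literature.NumberTheory.GaloisRepresentations

/-! ### Coordinates in `B ⊗ V` along a basis of `V` (generic) -/

namespace PeriodRingData

universe u₁ u₂ u₃ u₄

variable {Γ : Type u₁} [Group Γ] {P : Type u₂} {E : Type u₃} [Field P] [Field E] [Algebra P E]
  (𝔅 : PeriodRingData.{u₁, u₂, u₃, u₄} Γ P E)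
  {V : Type*} [AddCommGroup V] [Module P V] {κ : Type*} [Fintype κ] [DecidableEq κ]
  (b : Module.Basis κ P V)

omit [DecidableEq κ] in
/-- `Σ_k f_k ⊗ b_k ∈ Fil^i B ⊗ V` when all `f_k ∈ Fil^i B`. [folklore] -/
theorem sum_tmul_mem_filTensor {i : ℤ} {f : κ → 𝔅.B} (hf : ∀ k, f k ∈ 𝔅.fil i) :
    ∑ k, f k ⊗ₜ[P] b k ∈ 𝔅.filTensor V i := by
  refine Submodule.sum_mem _ fun k _ => ?_
  exact ⟨(⟨f k, hf k⟩ : 𝔅.fil i) ⊗ₜ[P] b k, by rw [AlgebraTensorModule.map_tmul]; rfl⟩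

/-- The `k`-th coordinate of `Σ_j f_j ⊗ b_j` along the basis `b` is `f_k`. [folklore] -/
theorem equivFinsuppOfBasisRight_sum_tmul {M : Type*} [AddCommGroup M] [Module P M] (f : κ → M) (k : κ) :
    TensorProduct.equivFinsuppOfBasisRight b (∑ j, f j ⊗ₜ[P] b j) k = f k := by
  rw [map_sum, Finsupp.finsetSum_apply]
  simp only [TensorProduct.equivFinsuppOfBasisRight_apply_tmul_apply, Module.Basis.repr_self,
    Finsupp.single_apply]
  rw [Finset.sum_eq_single k]
  · rw [if_pos rfl, one_smul]
  · intro j _ hjk; rw [if_neg hjk, zero_smul]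
  · intro h; exact absurd (Finset.mem_univ k) h

omit [Fintype κ] in
/-- Coordinates commute with the inclusion `Fil^i B ⊗ V → B ⊗ V`. [folklore] -/
theorem equivFinsuppOfBasisRight_map_subtype (i : ℤ) (y : (𝔅.fil i) ⊗[P] V) (k : κ) :
    TensorProduct.equivFinsuppOfBasisRight b
        (AlgebraTensorModule.map (𝔅.fil i).subtype (LinearMap.id : V →ₗ[P] V) y) k =
      ((TensorProduct.equivFinsuppOfBasisRight b y k : 𝔅.fil i) : 𝔅.B) := by
  induction y using TensorProduct.induction_on with
  | zero => simp
  | tmul m v =>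
    rw [AlgebraTensorModule.map_tmul, Submodule.subtype_apply, LinearMap.id_apply,
      TensorProduct.equivFinsuppOfBasisRight_apply_tmul_apply,
      TensorProduct.equivFinsuppOfBasisRight_apply_tmul_apply, Submodule.coe_smul_of_tower]
  | add x y hx hy => rw [map_add, map_add, Finsupp.add_apply, hx, hy, map_add, Finsupp.add_apply, Submodule.coe_add]

/-- **Coordinates detect the filtration**: if `Σ_k f_k ⊗ b_k ∈ Fil^i B ⊗ V` for a basis `b` of `V`,
then every `f_k ∈ Fil^i B`. [folklore] -/
theorem mem_fil_of_sum_tmul_mem_filTensor {i : ℤ} {f : κ → 𝔅.B}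
    (h : ∑ k, f k ⊗ₜ[P] b k ∈ 𝔅.filTensor V i) (k : κ) : f k ∈ 𝔅.fil i := by
  obtain ⟨y, hy⟩ := h
  have h1 := equivFinsuppOfBasisRight_sum_tmul b f k
  rw [← hy, equivFinsuppOfBasisRight_map_subtype] at h1
  rw [← h1]
  exact SetLike.coe_mem _

end PeriodRingData

end Literature.NumberTheory.GaloisRepresentations

namespace Literature.NumberTheory.PAdicHodge

open Literature.NumberTheory.GaloisRepresentations
open Literature.NumberTheory.GaloisRepresentations.IsNonarchimedeanLocalField

variable {F : Type} [Field F] [ValuativeRel F] [TopologicalSpace F] [IsNonarchimedeanLocalField F]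
  {p : ℕ} [CharZero F] [Fact p.Prime] (hp : valuation F p < 1)

namespace HT

omit [CharZero F] [Fact p.Prime] in
/-- `ι_HT` lands in degree `0`, hence in `Fil^i B_HT` for `i ≤ 0`. [folklore] -/
theorem iotaHT_mem_fil (x : maxUnramifiedCompletion F) {i : ℤ} (hi : i ≤ 0) : iotaHT hp x ∈ fil hp i := by
  change algebraMap (CompletedAlgClosure F) (HT hp) (maxUnramifiedCompletion.toC F x) ∈ fil hp i
  intro n hn
  rw [algebraMap_C_eq, coeff_mono, if_neg (by omega)]

omit [CharZero F] [Fact p.Prime] in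
/-- A degree-`0` element of `B_HT` in `Fil¹` vanishes: `(c T⁰)_0 = c = 0`. [folklore] -/
theorem eq_zero_of_algebraMap_mem_fil_one {c : CompletedAlgClosure F}
    (h : algebraMap (CompletedAlgClosure F) (HT hp) c ∈ fil hp 1) : c = 0 := by
  have := h 0 zero_lt_one
  rwa [algebraMap_C_eq, coeff_mono, if_pos rfl] at this

omit [CharZero F] [Fact p.Prime] in
/-- **The linear system**: if `Σ_j c_j ι(X_{kj}) ∈ Fil¹ B_HT` for all `k`, with `X` invertible over
`𝒪̂_{F_nr}` and `c_j ∈ F`, then `c = 0` (the degree-`0` coordinates `Σ_j c_j ι(X_{kj})` vanish and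
`ι(X)` is invertible over `ℂ_F`). [folklore] -/
theorem eq_zero_of_sum_smul_iotaHT_mem_fil_one {N : ℕ} {X : Matrix (Fin N) (Fin N) (maxUnramifiedCompletion F)}
    (hX : IsUnit X) {c : Fin N → F} (h : ∀ k, (∑ j, c j • iotaHT hp (X k j)) ∈ fil hp 1) : c = 0 := by
  classical
  set Y : Matrix (Fin N) (Fin N) (CompletedAlgClosure F) := (maxUnramifiedCompletion.toC F).mapMatrix X with hY
  have hYu : IsUnit Y := hX.map _
  set d : Fin N → CompletedAlgClosure F := fun j => algebraMap F (CompletedAlgClosure F) (c j) with hd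
  have hsum : ∀ k, ∑ j, c j • iotaHT hp (X k j) =
      algebraMap (CompletedAlgClosure F) (HT hp) ((Y.mulVec d) k) := by
    intro k
    rw [Matrix.mulVec, dotProduct, map_sum]
    refine Finset.sum_congr rfl fun j _ => ?_
    change c j • algebraMap (CompletedAlgClosure F) (HT hp) (maxUnramifiedCompletion.toC F (X k j)) = _
    rw [Algebra.smul_def, IsScalarTower.algebraMap_apply F (CompletedAlgClosure F) (HT hp), ← map_mul,
      mul_comm]
    rfl
  have hd0 : Y.mulVec d = 0 := by
    funext k
    exact eq_zero_of_algebraMap_mem_fil_one hp (by rw [← hsum]; exact h k)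
  have hdz : d = 0 := Matrix.mulVec_injective_of_isUnit hYu (by rw [hd0, Matrix.mulVec_zero])
  funext j
  have := congrFun hdz j
  simp only [hd, Pi.zero_apply, map_eq_zero] at this
  exact this

end HT

-- Mathlib's own global value of `maxSynthPendingDepth` (as in `PeriodRingData.isAdmissible_of_unramified`).
set_option maxSynthPendingDepth 3 in
/-- **Hodge filtration of `D_HT(V)` for unramified `V`**: `dim_F Fil^i D = dim V` for `i ≤ 0` and `= 0`
for `i ≥ 1` — `D` has an `F`-basis of vectors `Σ_i ι(X_{ij}) ⊗ b_i` with degree-`0` coefficients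
(period matrix of the unramified integral frame), and `X` is invertible.
[cite: FontaineAsterisque223III, Exp. III §5] [cite: FontaineOuyang2022, Prop. 2.14] -/
theorem finrank_filD_of_unramified [Algebra ℚ_[p] F]
    {V : Type} [AddCommGroup V] [Module ℚ_[p] V] [TopologicalSpace V] [IsTopologicalAddGroup V]
    [ContinuousSMul ℚ_[p] V] [T2Space V] [FiniteDimensional ℚ_[p] V]
    (ρ : ContinuousRep (absoluteGaloisGroup F) ℚ_[p] V)
    (hρ : ∀ σ ∈ absInertia F, ∀ v : V, ρ σ v = v) (i : ℤ) :
    Module.finrank F ((hodgeTatePeriodRingData hp).filD ρ i) =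
      if i ≤ 0 then Module.finrank ℚ_[p] V else 0 := by
  classical
  haveI : CompactSpace (absoluteGaloisGroup F) := absoluteGaloisGroup_compactSpace F
  set 𝔅 := hodgeTatePeriodRingData hp with h𝔅
  let ι : maxUnramifiedCompletion F →+* 𝔅.B := HT.iotaHT hp
  have hισ : ∀ (σ : absoluteGaloisGroup F) (x : maxUnramifiedCompletion F),
      σ • ι x = ι (maxUnramifiedCompletion.galAut F σ x) := fun σ x => HT.smul_iotaHT hp σ x
  have hιa : ∀ a : 𝒪[F], ι (algebraMap 𝒪[F] (maxUnramifiedCompletion F) a) = algebraMap F 𝔅.B (a : F) :=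
    fun a => HT.iotaHT_algebraMap hp a
  set N := Module.finrank ℚ_[p] V with hN
  -- an integral frame
  obtain ⟨b, r, hbr⟩ := ρ.exists_basis_integralFrame
  -- `r` is unramified
  have hr : ∀ σ ∈ absInertia F, r σ = 1 := by
    intro σ hσ
    refine Units.ext (Matrix.ext fun i j => PadicInt.ext ?_)
    have h1 := hbr σ j
    rw [hρ σ hσ] at h1
    have h2 := congrArg (fun v => b.repr v i) h1
    simp only [b.repr_sum_self, b.repr_self_apply] at h2
    rw [← h2, Units.val_one, Matrix.one_apply]
    by_cases hij : i = j
    · subst hij; simp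
    · rw [if_neg (Ne.symm hij), if_neg hij, PadicInt.coe_zero]
  -- the period matrix over `𝒪̂_{F_nr}` and its image `Y` in `B`
  obtain ⟨X, hXu, hX⟩ := exists_isUnit_forall_eq_mul_galAut (p := p) r hr
  have hιp : ∀ z : ℤ_[p], ι (padicIntToCompletion F p z) = algebraMap ℚ_[p] 𝔅.B (z : ℚ_[p]) := fun z => by
    rw [padicIntToCompletion, RingHom.comp_apply, hιa, coe_padicIntToInteger, PeriodRingData.algebraMap_eq]
  set Y : Matrix (Fin N) (Fin N) 𝔅.B := ι.mapMatrix X with hYdef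
  have hYapply : ∀ i j, Y i j = ι (X i j) := fun i j => rfl
  have hY : ∀ (σ : absoluteGaloisGroup F) (k j : Fin N),
      Y k j = ∑ i, (((r σ : GL (Fin N) ℤ_[p]) : Matrix (Fin N) (Fin N) ℤ_[p]) k i : ℚ_[p]) • σ • Y i j := by
    intro σ k j
    have h := congrArg (fun M : Matrix (Fin N) (Fin N) (maxUnramifiedCompletion F) => ι (M k j)) (hX σ)
    simp only [Matrix.mul_apply, map_sum, map_mul] at h
    rw [hYapply, h]
    refine Finset.sum_congr rfl fun i _ => ?_
    simp only [RingHom.mapMatrix_apply, Matrix.map_apply, RingEquiv.toRingHom_eq_coe, RingEquiv.coe_toRingHom]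
    rw [hιp, ← hισ, hYapply, Algebra.smul_def]
  -- the invariant vectors
  let w : Fin N → 𝔅.B ⊗[ℚ_[p]] V := fun j => ∑ i, Y i j ⊗ₜ[ℚ_[p]] b i
  have hwD : ∀ j, w j ∈ 𝔅.D ρ := by
    intro j
    rw [PeriodRingData.mem_D_iff]
    intro σ
    simp only [w, map_sum, PeriodRingData.tensorRep_apply_tmul]
    calc ∑ i, (σ • Y i j) ⊗ₜ[ℚ_[p]] ρ σ (b i)
        = ∑ i, ∑ k, ((((r σ : GL (Fin N) ℤ_[p]) : Matrix (Fin N) (Fin N) ℤ_[p]) k i : ℚ_[p]) • σ • Y i j) ⊗ₜ[ℚ_[p]] b k := by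
          refine Finset.sum_congr rfl fun i _ => ?_
          rw [hbr σ i, TensorProduct.tmul_sum]
          refine Finset.sum_congr rfl fun k _ => ?_
          exact (TensorProduct.smul_tmul _ _ _).symm
      _ = ∑ k, (∑ i, (((r σ : GL (Fin N) ℤ_[p]) : Matrix (Fin N) (Fin N) ℤ_[p]) k i : ℚ_[p]) • σ • Y i j) ⊗ₜ[ℚ_[p]] b k := by
          rw [Finset.sum_comm]
          refine Finset.sum_congr rfl fun k _ => ?_
          rw [TensorProduct.sum_tmul]
      _ = ∑ k, Y k j ⊗ₜ[ℚ_[p]] b k := Finset.sum_congr rfl fun k _ => by rw [← hY σ k j]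
  -- they are linearly independent over `B`, hence over `F`
  let β : Module.Basis (Fin N) 𝔅.B (𝔅.B ⊗[ℚ_[p]] V) := Algebra.TensorProduct.basis 𝔅.B b
  have hYdet : IsUnit Y.det := (Matrix.isUnit_iff_isUnit_det _).1 (hXu.map ι.mapMatrix)
  have hw : ∀ j, w j = Matrix.toLin β β Y (β j) := by
    intro j
    rw [Matrix.toLin_self]
    refine Finset.sum_congr rfl fun i _ => ?_
    rw [Algebra.TensorProduct.basis_apply, TensorProduct.smul_tmul', smul_eq_mul, mul_one]
  have hliB : LinearIndependent 𝔅.B w := by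
    have h := β.linearIndependent.map' (Matrix.toLin β β Y) (Matrix.ker_toLin_eq_bot β Y hYdet)
    rw [show w = ⇑(Matrix.toLin β β Y) ∘ ⇑β from funext hw]
    exact h
  have hliF : LinearIndependent F w := by
    refine hliB.restrict_scalars ?_
    intro x y hxy
    have h : algebraMap F 𝔅.B x = algebraMap F 𝔅.B y := by
      simpa only [Algebra.smul_def, mul_one] using hxy
    exact (algebraMap F 𝔅.B).injective h
  have hliD : LinearIndependent F (fun j => (⟨w j, hwD j⟩ : 𝔅.D ρ)) :=
    LinearIndependent.of_comp (𝔅.D ρ).subtype (by exact hliF)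
  -- `dim D = N` (admissibility), so the `w j` form a basis of `D`
  have hadm : Module.finrank F (𝔅.D ρ) = N := isAdmissible_hodgeTate_of_unramified hp ρ hρ
  haveI : FiniteDimensional F (𝔅.D ρ) :=
    Module.rank_lt_aleph0_iff.mp (lt_of_le_of_lt (𝔅.rank_D_le ρ) (Cardinal.natCast_lt_aleph0 (n := N)))
  have hcard : Fintype.card (Fin N) = Module.finrank F (𝔅.D ρ) := by rw [Fintype.card_fin, hadm]
  let bD : Module.Basis (Fin N) F (𝔅.D ρ) := basisOfLinearIndependentOfCardEqFinrank' _ hliD hcard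
  have hbD : ∀ j, ((bD j : 𝔅.D ρ) : 𝔅.B ⊗[ℚ_[p]] V) = w j := fun j => by
    rw [show bD j = (⟨w j, hwD j⟩ : 𝔅.D ρ) from
      congrFun (coe_basisOfLinearIndependentOfCardEqFinrank' _ hliD hcard) j]
  -- coordinates of an element of `D`
  have hrepr : ∀ x : 𝔅.D ρ, (x : 𝔅.B ⊗[ℚ_[p]] V) = ∑ k, (∑ j, bD.repr x j • Y k j) ⊗ₜ[ℚ_[p]] b k := by
    intro x
    have h1 : (x : 𝔅.B ⊗[ℚ_[p]] V) = ∑ j, bD.repr x j • w j := by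
      conv_lhs => rw [← bD.sum_repr x]
      rw [Submodule.coe_sum]
      refine Finset.sum_congr rfl fun j _ => ?_
      rw [Submodule.coe_smul, hbD]
    rw [h1]
    calc ∑ j, bD.repr x j • w j = ∑ j, ∑ k, (bD.repr x j • Y k j) ⊗ₜ[ℚ_[p]] b k := by
          refine Finset.sum_congr rfl fun j _ => ?_
          change bD.repr x j • ∑ k, Y k j ⊗ₜ[ℚ_[p]] b k = _
          rw [Finset.smul_sum]
          refine Finset.sum_congr rfl fun k _ => ?_
          rw [TensorProduct.smul_tmul']
      _ = ∑ k, ∑ j, (bD.repr x j • Y k j) ⊗ₜ[ℚ_[p]] b k := Finset.sum_comm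
      _ = ∑ k, (∑ j, bD.repr x j • Y k j) ⊗ₜ[ℚ_[p]] b k := by
          refine Finset.sum_congr rfl fun k _ => ?_
          rw [TensorProduct.sum_tmul]
  by_cases hi : i ≤ 0
  · -- `Fil^i D = D`
    have htop : 𝔅.filD ρ i = ⊤ := by
      rw [eq_top_iff]
      intro x _
      rw [PeriodRingData.mem_filD_iff, hrepr x]
      refine 𝔅.sum_tmul_mem_filTensor b fun k => Submodule.sum_mem _ fun j _ => Submodule.smul_mem _ _ ?_
      exact HT.iotaHT_mem_fil hp (X k j) hi
    rw [if_pos hi, htop, finrank_top, hadm]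
  · -- `Fil^i D = 0` for `i ≥ 1`
    have hbot : 𝔅.filD ρ i = ⊥ := by
      rw [eq_bot_iff]
      intro x hx
      have hx1 : x ∈ 𝔅.filD ρ 1 := 𝔅.filD_antitone ρ (show (1 : ℤ) ≤ i by omega) hx
      rw [PeriodRingData.mem_filD_iff, hrepr x] at hx1
      have hg : ∀ k, (∑ j, bD.repr x j • Y k j) ∈ 𝔅.fil 1 := fun k =>
        𝔅.mem_fil_of_sum_tmul_mem_filTensor b hx1 k
      have hc : (fun j => bD.repr x j) = 0 :=
        HT.eq_zero_of_sum_smul_iotaHT_mem_fil_one hp hXu (c := fun j => bD.repr x j) hg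
      rw [Submodule.mem_bot]
      apply bD.repr.injective
      rw [map_zero]
      ext j
      exact congrFun hc j
    rw [if_neg hi, hbot, finrank_bot]

/-- **Unramified representations have all Hodge–Tate weights `0`** (for the genuine Hodge–Tate
datum `B_HT(F)`): `hodgeTateWeights ρ = {0, …, 0}` (`dim ρ` times) for every continuous
finite-dimensional `ℚ_p`-linear `ρ` with trivial inertia action — the `B_HT` form of clause (F3)
`UnramifiedWeightsZero`. [cite: FontaineAsterisque223III, Exp. III §5] [cite: FontaineOuyang2022, Prop. 2.14] -/
theorem hodgeTateWeights_of_unramified [Algebra ℚ_[p] F]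
    {V : Type} [AddCommGroup V] [Module ℚ_[p] V] [TopologicalSpace V] [IsTopologicalAddGroup V]
    [ContinuousSMul ℚ_[p] V] [T2Space V] [FiniteDimensional ℚ_[p] V]
    (ρ : ContinuousRep (absoluteGaloisGroup F) ℚ_[p] V)
    (hρ : ∀ σ ∈ absInertia F, ∀ v : V, ρ σ v = v) :
    (hodgeTatePeriodRingData hp).hodgeTateWeights ρ = Multiset.replicate (Module.finrank ℚ_[p] V) 0 := by
  rw [PeriodRingData.hodgeTateWeights_eq_jumpMultiset]
  have h : (fun i => Module.finrank F ((hodgeTatePeriodRingData hp).filD ρ i)) =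
      fun i => if i ≤ 0 then Module.finrank ℚ_[p] V else 0 :=
    funext fun i => finrank_filD_of_unramified hp ρ hρ i
  rw [h, jumpMultiset_step]

end Literature.NumberTheory.PAdicHodge

end
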